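import Summits.Parity.GeneralizedHardyLittlewood.Theorems.FordMaynardSieveConst01651SieveConst01651InvBrackets
import Mathlib.MeasureTheory.Integral.Prod
import Mathlib.MeasureTheory.Measure.Lebesgue.Basic
import HarnessLib

/-!
# Route `FordMaynardSieveConst01651`, target `SieveConst01651` (stmt-Parity-19185), stub `stub_certValuePos` (R2):
# rectangle brackets — `∫∫_R Ψ(y₁+y₂)/(y₁y₂)` between `Ψ⁻·tangent·tangent` and `Ψ⁺·chord·chord`

Def-free helper file (step (6) of the `certP`/`certN` soundness, see `…CertAssembly`).  On a grid rectangle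
`R = [u₀/J, (u₀+S)/J] × [v₀/J, (v₀+T)/J]` (`u₀, v₀ > 0`), for a bounded measurable `Ψ` with `L ≤ Ψ(y₁+y₂) ≤ U` on `R`
and `L ≥ 0`:

  `L · 2S/(2u₀+S) · 2T/(2v₀+T) ≤ ∫_R Ψ(y₁+y₂)/(y₁y₂) ≤ U · S(2u₀+S)/(2u₀(u₀+S)) · T(2v₀+T)/(2v₀(v₀+T))`

(`rect_integral_ge`, `rect_integral_le`) — the two formulas of `rectPos` / `rectNeg` in `…BuchstabCert`, scale-free in
`J`; from `setIntegral_prod_mul` and the one-dimensional brackets of `…InvBrackets`.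

References: folklore (Hermite–Hadamard), Fubini.
-/

noncomputable section

open MeasureTheory Set intervalIntegral

namespace Summit.Parity.GeneralizedHardyLittlewood.FordMaynardSieveConst01651SieveConst01651

/-- `∫_{[a, b]} dy/y = ∫_a^b dy/y` for `0 < a ≤ b`. [folklore] -/
theorem setIntegral_Icc_inv {a b : ℝ} (hab : a ≤ b) :
    ∫ y in Set.Icc a b, 1 / y = ∫ y in a..b, 1 / y := by
  rw [intervalIntegral.integral_of_le hab, integral_Icc_eq_integral_Ioc]

/-- The grid brackets in real coordinates: tangent. [folklore] -/
theorem inv_integral_grid_ge {J : ℝ} (hJ : 0 < J) {u₀ S : ℕ} (hu : 0 < u₀) :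
    (2 : ℝ) * S / (2 * u₀ + S) ≤ ∫ y in Set.Icc ((u₀ : ℝ) / J) (((u₀ : ℝ) + S) / J), 1 / y := by
  have hu' : (0 : ℝ) < (u₀ : ℝ) / J := by positivity
  have hS' : (0 : ℝ) ≤ (S : ℝ) / J := by positivity
  have h := integral_inv_ge_tangent hu' hS'
  rw [setIntegral_Icc_inv (by rw [add_div]; linarith), show ((u₀ : ℝ) + S) / J = (u₀ : ℝ) / J + (S : ℝ) / J by ring]
  refine le_trans (le_of_eq ?_) h
  have h2 : (2 : ℝ) * u₀ + S ≠ 0 := by positivity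
  field_simp

/-- The grid brackets in real coordinates: chord. [folklore] -/
theorem inv_integral_grid_le {J : ℝ} (hJ : 0 < J) {u₀ S : ℕ} (hu : 0 < u₀) :
    ∫ y in Set.Icc ((u₀ : ℝ) / J) (((u₀ : ℝ) + S) / J), 1 / y ≤
      (S : ℝ) * (2 * u₀ + S) / (2 * u₀ * (u₀ + S)) := by
  have hu' : (0 : ℝ) < (u₀ : ℝ) / J := by positivity
  have hS' : (0 : ℝ) ≤ (S : ℝ) / J := by positivity
  have h := integral_inv_le_chord hu' hS'
  rw [setIntegral_Icc_inv (by rw [add_div]; linarith), show ((u₀ : ℝ) + S) / J = (u₀ : ℝ) / J + (S : ℝ) / J by ring]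
  refine le_trans h (le_of_eq ?_)
  have h1 : (u₀ : ℝ) ≠ 0 := by positivity
  have h2 : (u₀ : ℝ) + S ≠ 0 := by positivity
  field_simp

/-- `∫_{[a,b]} dy/y ≥ 0` for `0 < a`. [folklore] -/
theorem inv_integral_Icc_nonneg {a b : ℝ} (ha : 0 < a) : 0 ≤ ∫ y in Set.Icc a b, 1 / y :=
  setIntegral_nonneg measurableSet_Icc fun y hy => by
    have : 0 < y := lt_of_lt_of_le ha hy.1
    positivity

/-- Integrability of a bounded measurable function of `y₁ + y₂` divided by `y₁y₂` on a rectangle in the open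
quadrant. [folklore] -/
theorem integrableOn_rect {Ψ : ℝ → ℝ} (hΨm : Measurable Ψ) {C : ℝ} (hΨC : ∀ x, |Ψ x| ≤ C)
    {a b c d : ℝ} (ha : 0 < a) (hc : 0 < c) :
    IntegrableOn (fun y : ℝ × ℝ => Ψ (y.1 + y.2) / (y.1 * y.2)) (Set.Icc a b ×ˢ Set.Icc c d)
      ((volume : Measure ℝ).prod volume) := by
  have hmeas : Measurable (fun y : ℝ × ℝ => Ψ (y.1 + y.2) / (y.1 * y.2)) :=
    (hΨm.comp (measurable_fst.add measurable_snd)).div (measurable_fst.mul measurable_snd)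
  have hC0 : 0 ≤ C := (abs_nonneg _).trans (hΨC 0)
  refine Measure.integrableOn_of_bounded (M := C / (a * c)) ?_ hmeas.aestronglyMeasurable ?_
  · rw [Measure.prod_prod]
    exact ENNReal.mul_ne_top measure_Icc_lt_top.ne measure_Icc_lt_top.ne
  · refine (ae_restrict_iff' (measurableSet_Icc.prod measurableSet_Icc)).2 (Filter.Eventually.of_forall ?_)
    rintro ⟨y1, y2⟩ ⟨hy1, hy2⟩
    simp only [Set.mem_Icc] at hy1 hy2
    have h1 : a ≤ y1 := hy1.1
    have h2 : c ≤ y2 := hy2.1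
    have hy1p : 0 < y1 := lt_of_lt_of_le ha h1
    have hy2p : 0 < y2 := lt_of_lt_of_le hc h2
    rw [Real.norm_eq_abs, abs_div, abs_of_pos (mul_pos hy1p hy2p), div_le_div_iff₀ (mul_pos hy1p hy2p) (mul_pos ha hc)]
    calc |Ψ (y1 + y2)| * (a * c) ≤ C * (a * c) := mul_le_mul_of_nonneg_right (hΨC _) (by positivity)
      _ ≤ C * (y1 * y2) := mul_le_mul_of_nonneg_left (mul_le_mul h1 h2 hc.le hy1p.le) hC0

/-- **Lower rectangle bracket** (the formula of `rectPos`): for `u₀, v₀ > 0`, `L ≥ 0` with `L ≤ Ψ(y₁+y₂)` on the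
grid rectangle, `L · 2S/(2u₀+S) · 2T/(2v₀+T) ≤ ∫∫_R Ψ(y₁+y₂)/(y₁y₂)`. [folklore] -/
theorem rect_integral_ge {Ψ : ℝ → ℝ} (hΨm : Measurable Ψ) {C : ℝ} (hΨC : ∀ x, |Ψ x| ≤ C) {J : ℝ} (hJ : 0 < J)
    {u₀ v₀ S T : ℕ} (hu : 0 < u₀) (hv : 0 < v₀) {L : ℝ} (hL0 : 0 ≤ L)
    (hL : ∀ y ∈ Set.Icc ((u₀ : ℝ) / J) (((u₀ : ℝ) + S) / J) ×ˢ Set.Icc ((v₀ : ℝ) / J) (((v₀ : ℝ) + T) / J),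
      L ≤ Ψ (y.1 + y.2)) :
    L * ((2 : ℝ) * S / (2 * u₀ + S)) * ((2 : ℝ) * T / (2 * v₀ + T)) ≤
      ∫ y in Set.Icc ((u₀ : ℝ) / J) (((u₀ : ℝ) + S) / J) ×ˢ Set.Icc ((v₀ : ℝ) / J) (((v₀ : ℝ) + T) / J),
        Ψ (y.1 + y.2) / (y.1 * y.2) ∂((volume : Measure ℝ).prod volume) := by
  have ha : (0 : ℝ) < (u₀ : ℝ) / J := by positivity
  have hc : (0 : ℝ) < (v₀ : ℝ) / J := by positivity
  set R := Set.Icc ((u₀ : ℝ) / J) (((u₀ : ℝ) + S) / J) ×ˢ Set.Icc ((v₀ : ℝ) / J) (((v₀ : ℝ) + T) / J) with hR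
  -- compare with the constant integrand `L/(y₁ y₂)`
  have hconst : Measurable (fun _ : ℝ => L) := measurable_const
  have hmono : ∫ y in R, (fun _ : ℝ => L) (y.1 + y.2) / (y.1 * y.2) ∂((volume : Measure ℝ).prod volume) ≤
      ∫ y in R, Ψ (y.1 + y.2) / (y.1 * y.2) ∂((volume : Measure ℝ).prod volume) := by
    refine setIntegral_mono_on (integrableOn_rect hconst (C := |L|) (fun _ => le_rfl) ha hc)
      (integrableOn_rect hΨm hΨC ha hc) (measurableSet_Icc.prod measurableSet_Icc) fun y hy => ?_
    have hy1 : 0 < y.1 := lt_of_lt_of_le ha hy.1.1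
    have hy2 : 0 < y.2 := lt_of_lt_of_le hc hy.2.1
    exact div_le_div_of_nonneg_right (hL y hy) (mul_pos hy1 hy2).le
  refine le_trans ?_ hmono
  -- the constant integrand factors
  have hfac : ∫ y in R, (fun _ : ℝ => L) (y.1 + y.2) / (y.1 * y.2) ∂((volume : Measure ℝ).prod volume) =
      L * ((∫ y in Set.Icc ((u₀ : ℝ) / J) (((u₀ : ℝ) + S) / J), 1 / y) *
        ∫ y in Set.Icc ((v₀ : ℝ) / J) (((v₀ : ℝ) + T) / J), 1 / y) := by
    rw [hR, ← setIntegral_prod_mul, ← MeasureTheory.integral_const_mul]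
    refine setIntegral_congr_fun (measurableSet_Icc.prod measurableSet_Icc) fun y _ => ?_
    simp only
    ring
  rw [hfac]
  have h1 := inv_integral_grid_ge hJ hu (S := S)
  have h2 := inv_integral_grid_ge hJ hv (S := T)
  have h1' : (0 : ℝ) ≤ 2 * S / (2 * u₀ + S) := by positivity
  have h2' : (0 : ℝ) ≤ 2 * T / (2 * v₀ + T) := by positivity
  rw [mul_assoc]
  exact mul_le_mul_of_nonneg_left (mul_le_mul h1 h2 h2' ((h1'.trans h1))) hL0

/-- **Upper rectangle bracket** (the formula of `rectNeg`): for `u₀, v₀ > 0`, `0 ≤ Ψ(y₁+y₂) ≤ U` on the grid rectangle,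
`∫∫_R Ψ(y₁+y₂)/(y₁y₂) ≤ U · S(2u₀+S)/(2u₀(u₀+S)) · T(2v₀+T)/(2v₀(v₀+T))`. [folklore] -/
theorem rect_integral_le {Ψ : ℝ → ℝ} (hΨm : Measurable Ψ) {C : ℝ} (hΨC : ∀ x, |Ψ x| ≤ C) {J : ℝ} (hJ : 0 < J)
    {u₀ v₀ S T : ℕ} (hu : 0 < u₀) (hv : 0 < v₀) {U : ℝ} (hU0 : 0 ≤ U)
    (hU : ∀ y ∈ Set.Icc ((u₀ : ℝ) / J) (((u₀ : ℝ) + S) / J) ×ˢ Set.Icc ((v₀ : ℝ) / J) (((v₀ : ℝ) + T) / J),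
      Ψ (y.1 + y.2) ≤ U) :
    ∫ y in Set.Icc ((u₀ : ℝ) / J) (((u₀ : ℝ) + S) / J) ×ˢ Set.Icc ((v₀ : ℝ) / J) (((v₀ : ℝ) + T) / J),
        Ψ (y.1 + y.2) / (y.1 * y.2) ∂((volume : Measure ℝ).prod volume) ≤
      U * ((S : ℝ) * (2 * u₀ + S) / (2 * u₀ * (u₀ + S))) * ((T : ℝ) * (2 * v₀ + T) / (2 * v₀ * (v₀ + T))) := by
  have ha : (0 : ℝ) < (u₀ : ℝ) / J := by positivity
  have hc : (0 : ℝ) < (v₀ : ℝ) / J := by positivity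
  set R := Set.Icc ((u₀ : ℝ) / J) (((u₀ : ℝ) + S) / J) ×ˢ Set.Icc ((v₀ : ℝ) / J) (((v₀ : ℝ) + T) / J) with hR
  have hconst : Measurable (fun _ : ℝ => U) := measurable_const
  have hmono : ∫ y in R, Ψ (y.1 + y.2) / (y.1 * y.2) ∂((volume : Measure ℝ).prod volume) ≤
      ∫ y in R, (fun _ : ℝ => U) (y.1 + y.2) / (y.1 * y.2) ∂((volume : Measure ℝ).prod volume) := by
    refine setIntegral_mono_on (integrableOn_rect hΨm hΨC ha hc)
      (integrableOn_rect hconst (C := |U|) (fun _ => le_rfl) ha hc) (measurableSet_Icc.prod measurableSet_Icc)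
      fun y hy => ?_
    have hy1 : 0 < y.1 := lt_of_lt_of_le ha hy.1.1
    have hy2 : 0 < y.2 := lt_of_lt_of_le hc hy.2.1
    exact div_le_div_of_nonneg_right (hU y hy) (mul_pos hy1 hy2).le
  refine le_trans hmono ?_
  have hfac : ∫ y in R, (fun _ : ℝ => U) (y.1 + y.2) / (y.1 * y.2) ∂((volume : Measure ℝ).prod volume) =
      U * ((∫ y in Set.Icc ((u₀ : ℝ) / J) (((u₀ : ℝ) + S) / J), 1 / y) *
        ∫ y in Set.Icc ((v₀ : ℝ) / J) (((v₀ : ℝ) + T) / J), 1 / y) := by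
    rw [hR, ← setIntegral_prod_mul, ← MeasureTheory.integral_const_mul]
    refine setIntegral_congr_fun (measurableSet_Icc.prod measurableSet_Icc) fun y _ => ?_
    simp only
    ring
  rw [hfac, mul_assoc]
  have h1 := inv_integral_grid_le hJ hu (S := S)
  have h2 := inv_integral_grid_le hJ hv (S := T)
  have h1' := inv_integral_Icc_nonneg (b := ((u₀ : ℝ) + S) / J) ha
  have h2' := inv_integral_Icc_nonneg (b := ((v₀ : ℝ) + T) / J) hc
  exact mul_le_mul_of_nonneg_left (mul_le_mul h1 h2 h2' (h1'.trans h1)) hU0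

end Summit.Parity.GeneralizedHardyLittlewood.FordMaynardSieveConst01651SieveConst01651

end
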